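import Summits.BirchSwinnertonDyer.BirchSwinnertonDyer.Theorems.ClassRecordThreeRegCertKernelO3Height
import Summits.BirchSwinnertonDyer.BirchSwinnertonDyer.Theorems.ClassRecordThreeRegCertKernelO2Cert
import HarnessLib

/-!
# Route `ClassRecordThree`, crux `SchneiderAtThree` (item 19106): the THIRD-ORDER REG3CERT kernel certificate
# (`v₃(e(Q)) = 1`, `v₃(h(Q)) ≤ 3`) — assembly `h mod 81` and the checker `certNonsplit_of_residueCertO3`
# (cell `bsd-stepL`, seat `bsd-stepL-reg3-eng` g3; `--supports stmt-BirchSwinnertonDyer-19106`)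

HONEST FRAMING: BSD is not proved by any of this; nothing here closes the crux; Schneider's conjecture (barrier
`PAdicHeightNondegeneracy`) is asserted NOWHERE; every application is ONE curve. Third-order twin of `…O2Height` §3 /
`…O2Cert`: residues `r ≡ q (mod 9)`, `γ ≡ C² (mod 81)`, `ζ, ℓ (mod 3⁵)`, `ω, κ (mod 3⁶)`, `u` with `9u = 2γκ(1 − 4rκ)`;
`h ≡ ½[(E − E²/2 + E³/3) − (U − U²/2 + U³/3)] (mod 81)`, `E = e'⁴ − 1`, `U = u² − 1`; CERTIFICATE
**`3⁵ ∤ 6E − 3E² + 2E³ − 6U + 3U² − 2U³`**. Validated offline on all 690 stored rows of kit j249075. Theorems only (0 defs, 0 facts).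
References: [SteinWuthrich2013] §4.2; [Iwasawa1972PadicL] §4.4; [SilvermanATAEC1994] V.3, V.5; [MazurSteinTate2006] §1.
-/

open scoped Classical
open WeierstrassCurve Literature.NumberTheory.EllipticCurves
  Literature.NumberTheory.EllipticCurves.Rank1Residual
  Literature.NumberTheory.EllipticCurves.SteinWuthrich2013
  Summit.BirchSwinnertonDyer.Rank1Residual
  Summit.BirchSwinnertonDyer.Rank1Residual.X11b
  Summit.BirchSwinnertonDyer.Rank1Residual.X11b.RegMult.Rung62310y1

namespace Summit.BirchSwinnertonDyer.Rank1Residual.X11b.RegMult.KernelCert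

/-- Ultrametric inequality for differences. [folklore] -/
private theorem norm_sub_le_max₈ (a b : ℚ_[3]) : ‖a - b‖ ≤ max ‖a‖ ‖b‖ := by
  rw [sub_eq_add_neg, ← norm_neg b]; exact IsUltrametricDist.norm_add_le_max a (-b)

/-- `a₃(W ⊗ ℚ₃) = a₃`. [folklore] -/
theorem baseChange_a₃_eq (W : WeierstrassCurve ℚ) {a₁ a₂ a₃ a₄ a₆ : ℤ} (hW : W = ⟨a₁, a₂, a₃, a₄, a₆⟩) :
    (W.baseChange ℚ_[3]).a₃ = a₃ := by
  subst hW; rw [WeierstrassCurve.baseChange, WeierstrassCurve.map_a₃]; simp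

/-- **The third-order REG3CERT kernel certificate (`v₃(e(Q)) = 1`, `v₃(h(Q)) ≤ 3`).** [cite: SteinWuthrich2013, §4.2]
[cite: Iwasawa1972PadicL, §4.4] [cite: SilvermanATAEC1994, Lemma V.5.1 and Thm. V.3.1] -/
theorem heightFourOneCoord_ne_zero_of_residueCertO3 (W : WeierstrassCurve ℚ) [W.IsElliptic] [W.IsGloballyMinimal]
    {a₁ a₂ a₃ c4 c6 D : ℤ} (ha1 : (W.baseChange ℚ_[3]).a₁ = a₁) (ha2 : (W.baseChange ℚ_[3]).a₂ = a₂)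
    (ha3 : (W.baseChange ℚ_[3]).a₃ = a₃)
    (hc4 : (W.baseChange ℚ_[3]).c₄ = c4) (hc6 : (W.baseChange ℚ_[3]).c₆ = c6) (h3c4 : ¬ (3 : ℤ) ∣ c4)
    (h3c6 : ¬ (3 : ℤ) ∣ c6) (hjinv : ((W.j : ℚ_[3]))⁻¹ = (D : ℚ_[3]) / (c4 : ℚ_[3]) ^ 3) (h3D : (3 : ℤ) ∣ D)
    {a b : ℤ} {e' : ℕ} (h3e' : ¬ (3 : ℤ) ∣ e') (h3b : ¬ (3 : ℤ) ∣ b) (hcop : Nat.Coprime a.natAbs (3 * e'))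
    {x y : ℚ} (hx : x = a / ((3 * e' : ℕ) : ℚ) ^ 2) (hy : y = b / ((3 * e' : ℕ) : ℚ) ^ 3)
    {r γ ζ ℓ ω κ u : ℤ} (hr : (9 : ℤ) ∣ D - r * c4 ^ 3)
    (hγ : (81 : ℤ) ∣ c4 * c4 ^ 3 * (c4 ^ 3 - 504 * D) + γ * c6 * ((c4 ^ 3) ^ 2 + 240 * D * c4 ^ 3 + 178560 * D ^ 2))
    (h3γ : ¬ (3 : ℤ) ∣ γ) (hζ : (243 : ℤ) ∣ a * (3 * e' : ℕ) + ζ * b)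
    (hℓ : (729 : ℤ) ∣ 12 * ζ + 6 * a₁ * ζ ^ 2 + 4 * (a₁ ^ 2 + a₂) * ζ ^ 3 + 3 * (a₁ ^ 3 + 2 * a₁ * a₂ + 2 * a₃) * ζ ^ 4 -
      12 * ℓ) (h3ℓ : (3 : ℤ) ∣ ℓ)
    (hω9 : (9 : ℤ) ∣ ω) (hω : (729 : ℤ) ∣ ℓ ^ 2 - ω * γ) (hκ9 : (9 : ℤ) ∣ κ)
    (hκ : (6561 : ℤ) ∣ 360 * ω + 30 * ω ^ 2 + ω ^ 3 - 720 * κ) (hu : 9 * u = 2 * γ * κ * (1 - 4 * r * κ))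
    (h3u : ¬ (3 : ℤ) ∣ u) (h3u2 : (3 : ℤ) ∣ u ^ 2 - 1)
    (hcert : ¬ (243 : ℤ) ∣ 6 * ((e' : ℤ) ^ 4 - 1) - 3 * ((e' : ℤ) ^ 4 - 1) ^ 2 + 2 * ((e' : ℤ) ^ 4 - 1) ^ 3 -
      6 * (u ^ 2 - 1) + 3 * (u ^ 2 - 1) ^ 2 - 2 * (u ^ 2 - 1) ^ 3)
    {q : ℚ_[3]} (hq : ‖q‖ < 1) (hj : tateJ q = (W.j : ℚ_[3])) : heightFourOneCoord W 3 q x y ≠ 0 := by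
  have hq3 : ‖q‖ ≤ 1 / 3 := norm_le_third_of_norm_lt_one hq
  have he0 : (3 * e' : ℕ) ≠ 0 := by have : e' ≠ 0 := (by rintro rfl; exact h3e' (by simp)); positivity
  have hb0 : b ≠ 0 := by rintro rfl; exact h3b (dvd_zero 3)
  have h3e : (3 : ℤ) ∣ ((3 * e' : ℕ) : ℤ) := ⟨e', by push_cast; ring⟩
  have hc4n : ‖(c4 : ℚ_[3])‖ = 1 := norm_intCast_eq_one_of_not_dvd h3c4
  have hJn : ‖(c4 : ℚ_[3]) ^ 3‖ = 1 := by rw [norm_pow, hc4n, one_pow]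
  have hJ0 : (c4 : ℚ_[3]) ^ 3 ≠ 0 := by intro h; rw [h, norm_zero] at hJn; exact zero_ne_one hJn
  have hc40 : (c4 : ℚ_[3]) ≠ 0 := by intro h; rw [h, norm_zero] at hc4n; exact zero_ne_one hc4n
  have hq0n : ‖(D : ℚ_[3]) / (c4 : ℚ_[3]) ^ 3‖ ≤ 1 / 3 := by
    rw [norm_div, hJn, div_one]; exact (norm_intCast_le_of_pow_dvd (k := 1) (by simpa using h3D)).trans (by norm_num)
  -- THE Tate parameter to second order, and `q ≡ r (mod 9)`
  have hq2 := norm_tateParam_sub_secondOrder_le hq hj hjinv hq0n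
  have hqD : ‖q - (D : ℚ_[3]) / (c4 : ℚ_[3]) ^ 3‖ ≤ 1 / 9 := by
    have h := norm_inv_tateJ_sub_le hq
    rw [hj, hjinv, ← norm_neg, neg_sub] at h
    exact h.trans (by calc ‖q‖ * ‖q‖ ≤ 1 / 3 * (1 / 3) := by gcongr
      _ = 1 / 9 := by norm_num)
  have hqr : ‖q - r‖ ≤ 1 / 9 := by
    rw [show q - (r : ℚ_[3]) = (q - (D : ℚ_[3]) / (c4 : ℚ_[3]) ^ 3) + (((D - r * c4 ^ 3 : ℤ) : ℚ_[3]) / (c4 : ℚ_[3]) ^ 3) by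
      push_cast; field_simp; ring]
    refine (IsUltrametricDist.norm_add_le_max _ _).trans (max_le hqD ?_)
    rw [norm_div, hJn, div_one]; exact (norm_intCast_le_of_pow_dvd (k := 2) (by norm_num; exact hr)).trans (by norm_num)
  have hC := norm_uniformisationScaleSq_sub_le_o3 W hc4 hc6 h3c4 h3c6 h3D hγ hq2
  -- `z`, `L ≡ ℓ (mod 3⁵)`
  have hζ81 : (81 : ℤ) ∣ a * (3 * e' : ℕ) + ζ * b := dvd_trans ⟨3, by norm_num⟩ hζ
  obtain ⟨-, hz⟩ := norm_z_sub_le (ζ := ζ) h3e h3b hζ81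
  have hbn : ‖(b : ℚ_[3])‖ = 1 := norm_intCast_eq_one_of_not_dvd h3b
  have hzζ : ‖-((a : ℚ_[3]) * ((3 * e' : ℕ) : ℚ_[3])) / (b : ℚ_[3]) - ζ‖ ≤ 1 / 243 := by
    have hb0' : (b : ℚ_[3]) ≠ 0 := by exact_mod_cast hb0
    rw [show -((a : ℚ_[3]) * ((3 * e' : ℕ) : ℚ_[3])) / (b : ℚ_[3]) - ζ =
      -(((a * (3 * e' : ℕ) + ζ * b : ℤ) : ℚ_[3])) / (b : ℚ_[3]) by push_cast; field_simp; ring, norm_div, norm_neg,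
      hbn, div_one]
    exact (norm_intCast_le_of_pow_dvd (k := 5) (by norm_num; exact hζ)).trans (by norm_num)
  have hL := norm_padicFormalLog_sub_intCast_le_o3 W ha1 ha2 ha3 hℓ hzζ hz
  have hℓn : ‖(ℓ : ℚ_[3])‖ ≤ 1 / 3 := (norm_intCast_le_of_pow_dvd (k := 1) (by simpa using h3ℓ)).trans (by norm_num)
  have hwdef : logUnitParamSq W 3 q x y =
      (W.baseChange ℚ_[3]).padicFormalLog (-((a : ℚ_[3]) * ((3 * e' : ℕ) : ℚ_[3])) / (b : ℚ_[3])) ^ 2 /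
        uniformisationScaleSq W 3 q := by
    rw [logUnitParamSq, hx, hy, neg_div_cast_eq hb0 he0]
  have hY := norm_mul_tateSigmaSq_sub_le_o3 hqr hq3 hL hℓn hC h3γ hω9 hω hκ9 hκ hu
  rw [← hwdef] at hY
  have hlogY := norm_padicLog_sub_le_of_norm_sub_le_o3 h3u h3u2 hY
  -- `den x = 9e'²`
  have hden : x.den = (3 * e') ^ 2 := by
    have hpos : (0 : ℤ) < ((3 * e' : ℕ) : ℤ) ^ 2 := by positivity
    have hcop2 : Nat.Coprime a.natAbs ((((3 * e' : ℕ) : ℤ) ^ 2).natAbs) := by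
      rw [Int.natAbs_pow, Int.natAbs_natCast]; exact hcop.pow_right 2
    have h := Rat.den_div_eq_of_coprime hpos hcop2
    have hx' : x = ((a : ℤ) : ℚ) / ((((3 * e' : ℕ) : ℤ) ^ 2 : ℤ) : ℚ) := by rw [hx]; push_cast; ring
    rw [← hx'] at h
    exact_mod_cast h
  have h3e2 : ¬ (3 : ℤ) ∣ ((e' : ℤ) ^ 2) := fun h => h3e' (Int.Prime.dvd_pow' (by norm_num) h)
  have h3e4 : (3 : ℤ) ∣ ((e' : ℤ) ^ 2) ^ 2 - 1 := by
    rw [show ((e' : ℤ) ^ 2) ^ 2 - 1 = (e' : ℤ) ^ 4 - 1 by ring]; exact three_dvd_pow_four_sub_one h3e'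
  have hYd : ‖(((x.den : ℚ)) : ℚ_[3]) - 9 * (((e' : ℤ) ^ 2 : ℤ) : ℚ_[3])‖ ≤ 1 / 729 := by
    rw [hden]; push_cast; ring_nf; rw [norm_zero]; norm_num
  have hlogd := norm_padicLog_sub_le_of_norm_sub_le_o3 h3e2 h3e4 hYd
  intro h0
  rw [heightFourOneCoord] at h0
  have heq := sub_eq_zero.mp h0
  rw [heq] at hlogd
  set PU : ℚ_[3] := (((u ^ 2 - 1 : ℤ)) : ℚ_[3]) - (((u ^ 2 - 1 : ℤ)) : ℚ_[3]) ^ 2 / 2 +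
    (((u ^ 2 - 1 : ℤ)) : ℚ_[3]) ^ 3 / 3 with hPU
  set PE : ℚ_[3] := (((((e' : ℤ) ^ 2) ^ 2 - 1 : ℤ)) : ℚ_[3]) - (((((e' : ℤ) ^ 2) ^ 2 - 1 : ℤ)) : ℚ_[3]) ^ 2 / 2 +
    (((((e' : ℤ) ^ 2) ^ 2 - 1 : ℤ)) : ℚ_[3]) ^ 3 / 3 with hPE
  have hdiff : ‖(2 : ℚ_[3])⁻¹ * PE - (2 : ℚ_[3])⁻¹ * PU‖ ≤ 1 / 81 := by
    have : (2 : ℚ_[3])⁻¹ * PE - (2 : ℚ_[3])⁻¹ * PU =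
        (padicLog 3 (uniformisationScaleSq W 3 q * tateSigmaSq q (coshOfSq (logUnitParamSq W 3 q x y))) -
          (2 : ℚ_[3])⁻¹ * PU) -
        (padicLog 3 (uniformisationScaleSq W 3 q * tateSigmaSq q (coshOfSq (logUnitParamSq W 3 q x y))) -
          (2 : ℚ_[3])⁻¹ * PE) := by ring
    rw [this]; exact (norm_sub_le_max₈ _ _).trans (max_le hlogY hlogd)
  have hid : (2 : ℚ_[3])⁻¹ * PE - (2 : ℚ_[3])⁻¹ * PU = (12 : ℚ_[3])⁻¹ *
      (((6 * ((e' : ℤ) ^ 4 - 1) - 3 * ((e' : ℤ) ^ 4 - 1) ^ 2 + 2 * ((e' : ℤ) ^ 4 - 1) ^ 3 -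
        6 * (u ^ 2 - 1) + 3 * (u ^ 2 - 1) ^ 2 - 2 * (u ^ 2 - 1) ^ 3 : ℤ)) : ℚ_[3]) := by
    have h2 : (2 : ℚ_[3]) ≠ 0 := by norm_num
    have h3 : (3 : ℚ_[3]) ≠ 0 := by norm_num
    have h12 : (12 : ℚ_[3]) ≠ 0 := by norm_num
    rw [hPE, hPU]; push_cast; field_simp; ring
  have h12n : ‖(12 : ℚ_[3])⁻¹‖ = 3 := by
    rw [show (12 : ℚ_[3]) = 4 * 3 by norm_num, mul_inv, norm_mul, norm_inv, norm_inv,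
      show (4 : ℚ_[3]) = ((4 : ℤ) : ℚ_[3]) by norm_cast, norm_intCast_eq_one_of_not_dvd (by decide),
      show (3 : ℚ_[3]) = ((3 : ℕ) : ℚ_[3]) by norm_cast, Padic.norm_p]; norm_num
  rw [hid, norm_mul, h12n] at hdiff
  have h243 : ((3 : ℕ) : ℤ) ^ 5 ∣ 6 * ((e' : ℤ) ^ 4 - 1) - 3 * ((e' : ℤ) ^ 4 - 1) ^ 2 + 2 * ((e' : ℤ) ^ 4 - 1) ^ 3 -
      6 * (u ^ 2 - 1) + 3 * (u ^ 2 - 1) ^ 2 - 2 * (u ^ 2 - 1) ^ 3 :=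
    (Padic.norm_int_le_pow_iff_dvd (p := 3) _ 5).mp (by
      have : ‖((((6 * ((e' : ℤ) ^ 4 - 1) - 3 * ((e' : ℤ) ^ 4 - 1) ^ 2 + 2 * ((e' : ℤ) ^ 4 - 1) ^ 3 -
          6 * (u ^ 2 - 1) + 3 * (u ^ 2 - 1) ^ 2 - 2 * (u ^ 2 - 1) ^ 3 : ℤ)) : ℚ_[3]))‖ ≤ 1 / 243 := by linarith
      exact this.trans (by norm_num))
  exact hcert (by simpa using h243)

/-- **`RegMult.CertNonsplit W 3 Q 1` from a THIRD-ORDER REG3CERT residue certificate (`v₃(e(Q)) = 1`, `v₃(h(Q)) ≤ 3`)** —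
one bundled integer hypothesis decided per row by `norm_num`. Per curve; nothing class-wide.
[cite: SteinWuthrich2013, §4.2] [cite: MazurSteinTate2006, §1] [cite: SilvermanAEC2009, VII.3.4] -/
theorem certNonsplit_of_residueCertO3 (W : WeierstrassCurve ℚ) {a₁ a₂ a₃ a₄ a₆ : ℤ} (hW : W = ⟨a₁, a₂, a₃, a₄, a₆⟩)
    [W.IsElliptic] [W.IsGloballyMinimal] {a b c4 c6 D r γ ζ ℓ ω κ u : ℤ} {e' n : ℕ}
    (H : c4 = (a₁ ^ 2 + 4 * a₂) ^ 2 - 24 * (2 * a₄ + a₁ * a₃) ∧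
      c6 = -(a₁ ^ 2 + 4 * a₂) ^ 3 + 36 * (a₁ ^ 2 + 4 * a₂) * (2 * a₄ + a₁ * a₃) - 216 * (a₃ ^ 2 + 4 * a₆) ∧
      D = -(a₁ ^ 2 + 4 * a₂) ^ 2 * (a₁ ^ 2 * a₆ + 4 * a₂ * a₆ - a₁ * a₃ * a₄ + a₂ * a₃ ^ 2 - a₄ ^ 2) -
        8 * (2 * a₄ + a₁ * a₃) ^ 3 - 27 * (a₃ ^ 2 + 4 * a₆) ^ 2 +
        9 * (a₁ ^ 2 + 4 * a₂) * (2 * a₄ + a₁ * a₃) * (a₃ ^ 2 + 4 * a₆) ∧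
      ¬ (3 : ℤ) ∣ c4 ∧ ¬ (3 : ℤ) ∣ c6 ∧ (3 : ℤ) ∣ D ∧ ¬ (3 : ℤ) ∣ e' ∧ ¬ (3 : ℤ) ∣ b ∧ Nat.Coprime a.natAbs (3 * e') ∧
      Int.gcd (2 * b + a₁ * a * (3 * e' : ℕ) + a₃ * (3 * e' : ℕ) ^ 3)
        (a₁ * b * (3 * e' : ℕ) - (3 * a ^ 2 + 2 * a₂ * a * (3 * e' : ℕ) ^ 2 + a₄ * (3 * e' : ℕ) ^ 4)) ∣ (3 * e') ^ n ∧
      (9 : ℤ) ∣ D - r * c4 ^ 3 ∧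
      (81 : ℤ) ∣ c4 * c4 ^ 3 * (c4 ^ 3 - 504 * D) + γ * c6 * ((c4 ^ 3) ^ 2 + 240 * D * c4 ^ 3 + 178560 * D ^ 2) ∧
      ¬ (3 : ℤ) ∣ γ ∧ (243 : ℤ) ∣ a * (3 * e' : ℕ) + ζ * b ∧
      (729 : ℤ) ∣ 12 * ζ + 6 * a₁ * ζ ^ 2 + 4 * (a₁ ^ 2 + a₂) * ζ ^ 3 + 3 * (a₁ ^ 3 + 2 * a₁ * a₂ + 2 * a₃) * ζ ^ 4 -
        12 * ℓ ∧ (3 : ℤ) ∣ ℓ ∧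
      (9 : ℤ) ∣ ω ∧ (729 : ℤ) ∣ ℓ ^ 2 - ω * γ ∧ (9 : ℤ) ∣ κ ∧ (6561 : ℤ) ∣ 360 * ω + 30 * ω ^ 2 + ω ^ 3 - 720 * κ ∧
      9 * u = 2 * γ * κ * (1 - 4 * r * κ) ∧ ¬ (3 : ℤ) ∣ u ∧ (3 : ℤ) ∣ u ^ 2 - 1 ∧
      ¬ (243 : ℤ) ∣ 6 * ((e' : ℤ) ^ 4 - 1) - 3 * ((e' : ℤ) ^ 4 - 1) ^ 2 + 2 * ((e' : ℤ) ^ 4 - 1) ^ 3 -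
        6 * (u ^ 2 - 1) + 3 * (u ^ 2 - 1) ^ 2 - 2 * (u ^ 2 - 1) ^ 3)
    {x y : ℚ} (hx : x = a / ((3 * e' : ℕ) : ℚ) ^ 2) (hy : y = b / ((3 * e' : ℕ) : ℚ) ^ 3)
    (h : W.toAffine.Nonsingular x y) : RegMult.CertNonsplit W 3 (.some x y h) 1 := by
  obtain ⟨hc4, hc6, hD, h3c4, h3c6, h3D, h3e', h3b, hcop, hgcd, hr, hγ, h3γ, hζ, hℓ, h3ℓ, hω9, hω, hκ9, hκ, hu, h3u,
    h3u2, hcert⟩ := H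
  have he'0 : e' ≠ 0 := by rintro rfl; exact h3e' (by simp)
  have he0 : (3 * e' : ℕ) ≠ 0 := by positivity
  have hx1 : 1 < ‖(x : ℚ_[3])‖ := by
    haveI : Fact (Nat.Prime 3) := ⟨Nat.prime_three⟩
    exact (one_lt_norm_ratCast_iff 3 x).mpr (padicValRat_x_neg he0 hx hcop (dvd_mul_right 3 e'))
  have hadm : W.IsAdmissible 3 (.some x y h) :=
    isAdmissible_of_one_lt_norm (by norm_num) h hx1 (hasNonsingularReductionAt_of_gcd W hW he0 hx hy hcop hgcd)
  refine ⟨by rw [one_smul]; exact hadm, fun q _ hq1 hqj => ?_⟩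
  rw [one_smul]
  exact heightFourOneCoord_ne_zero_of_residueCertO3 W (baseChange_a₁_eq W hW) (baseChange_a₂_eq W hW)
    (baseChange_a₃_eq W hW) (baseChange_c₄_eq W hW hc4) (baseChange_c₆_eq W hW hc6) h3c4 h3c6 (ratCast_j_inv_eq W hW hc4 hD)
    h3D h3e' h3b hcop hx hy hr hγ h3γ hζ hℓ h3ℓ hω9 hω hκ9 hκ hu h3u h3u2 hcert hq1 hqj

end Summit.BirchSwinnertonDyer.Rank1Residual.X11b.RegMult.KernelCert
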